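import Literature.NumberTheory.ComplexMultiplication.QuarticCMGaloisDihedral
import Literature.AlgebraicGeometry.Pohlmann1968.NondegenerateCMTypeDivisorClasses
import HarnessLib

/-!
# The dihedral Galois closure of a non-Galois quartic CM field has NO primitive CM type

Sequel of `NumberTheory/ComplexMultiplication/QuarticCMGaloisDihedral` (Shimura §8.4 Example (2)(C): for a quartic
CM field `K` NOT normal over `ℚ`, the normal closure `L` is a CM field of degree `8` with `Gal(L/ℚ) ≅ D₄`,
`rⁱ ↦ σⁱ`, `srⁱ ↦ τσⁱ`, `σ² = ρ` complex conjugation).  Shimura's Example (1) of §8.4 reads the CM types of a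
GALOIS CM field `L` inside `G = Gal(L/ℚ)` ("we consider the `φᵢ` as elements of `G`"): a CM type is a subset
`S ⊂ G` with `G = S ⊔ ρS`, and by §8.2 Prop. 26 it is primitive iff `{γ ∈ G | Sγ = S} = {1}`.  For `G = D₄`
(`ρ = r²` central) NO such `S` is primitive: writing `S = {r^a, r^b, sr^c, sr^d}` (`a, c` even, `b, d` odd), exactly
one of `a + c ≡ b + d`, `a + d ≡ b + c (mod 4)` holds and gives a reflection `sr^j` with `S·sr^j = S`.  Hence:

* **`not_isPrimitive_of_isNormalClosure`** — for `L` a normal closure of a non-Galois quartic CM field, NO complex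
  CM type `Θ` of `L` is primitive (at any base embedding); **`not_isNondegenerate_of_isNormalClosure`** — none is
  nondegenerate (Kubota: nondegenerate ⟹ primitive); so every CM abelian fourfold with CM by `L` is non-simple.
* **`not_isPrimitive_of_isGalois_of_ringHom`**, **`not_isNondegenerate_of_isGalois_of_ringHom`** — the same for
  ANY Galois CM field `F` of degree `8` receiving a non-Galois quartic CM field (such an `F` is a normal closure,
  `isNormalClosure_of_isGalois_octic`).
* `exists_ne_one_mul_mem_iff` — the group-theoretic core in `Gal(L/ℚ)`: every `S ⊂ G` with `δ ∈ S ↔ ρδ ∉ S` has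
  a right stabiliser `γ ≠ 1` (transported from `DihedralGroup 4`, where it is a finite check by `decide`,
  `dihedralGroup_four_exists_ne_one_forall_mul_eq`).

Consumed by the COR-CM cell (`Summits/HodgeConjecture/CorCM/QuarticCMSubfieldOfOcticHodge`,
`…/QuarticCMReflexInOcticHodge`): the hypothesis "`K_F` not Galois" there only excludes `K_F ≅ L`, where no
nondegenerate type exists anyway.  Theorems only; no definition, no named fact, no `sorry`.

## References

* [Shimura1998] G. Shimura, *Abelian Varieties with Complex Multiplication and Modular Functions*, §8.4 Examples
  (1) and (2)(C); §8.2 Prop. 26.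
* [Kubota1965] T. Kubota, *On the field extension by complex multiplication*, §2 ("a nondegenerate CM-type is
  primitive").
-/

set_option autoImplicit false

namespace Literature.NumberTheory.ComplexMultiplication

open NumberField NumberField.ComplexEmbedding IntermediateField
open Literature.AlgebraicGeometry.Motives (CMType)
open Literature.AlgebraicGeometry.Pohlmann1968

/-! ### §1 The finite check in `D₄` -/

set_option maxRecDepth 8000 in
/-- **No CM type of `D₄` (for the central involution `r²`) is primitive**: every `f : D₄ → Bool` with
`f(δ) = ¬ f(r²δ)` is invariant under right multiplication by some `γ ≠ 1` (a reflection).  Finite check over the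
`16` types. [cite: Shimura1998, §8.4 Example (1)] -/
theorem dihedralGroup_four_exists_ne_one_forall_mul_eq :
    ∀ f : DihedralGroup 4 → Bool, (∀ δ : DihedralGroup 4, f δ = !f (DihedralGroup.r 2 * δ)) →
      ∃ γ : DihedralGroup 4, γ ≠ 1 ∧ ∀ δ : DihedralGroup 4, f (δ * γ) = f δ := by
  decide

/-! ### §2 Transport to `Gal(L/ℚ)` and to the complex embeddings of `L` -/

section Galois

variable {K : Type} [Field K] [NumberField K] [IsCMField K] {L : Type} [Field L] [NumberField L] [IsCMField L]
  [IsNormalClosure ℚ K L]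

/-- **Every "CM type read in `G = Gal(L/ℚ)`" has a non-trivial right stabiliser** (`L` the normal closure of a
non-Galois quartic CM field `K`): for `S ⊆ G` with `δ ∈ S ↔ ρδ ∉ S` there is `γ ≠ 1` with `δγ ∈ S ↔ δ ∈ S` for all
`δ`. [cite: Shimura1998, §8.4 Examples (1), (2)(C)] -/
theorem exists_ne_one_mul_mem_iff (h4 : Module.finrank ℚ K = 4) (hK : ¬ IsGalois ℚ K) (S : Set (L ≃ₐ[ℚ] L))
    (hS : ∀ δ : L ≃ₐ[ℚ] L, δ ∈ S ↔ conjGal (L := L) * δ ∉ S) :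
    ∃ γ : L ≃ₐ[ℚ] L, γ ≠ 1 ∧ ∀ δ : L ≃ₐ[ℚ] L, δ * γ ∈ S ↔ δ ∈ S := by
  classical
  obtain ⟨a⟩ : Nonempty (K →ₐ[ℚ] L) := by
    have hE : Fintype.card (K →ₐ[ℚ] L) = 4 := by rw [card_algHom_eq_finrank K, h4]
    exact Fintype.card_pos_iff.1 (by rw [hE]; norm_num)
  obtain ⟨b, hba, hbc⟩ := QuarticCMDihedral.exists_ne_ne h4 a
  obtain ⟨σ, τ, hσ, hτ⟩ := QuarticCMDihedral.exists_sigma_tau h4 hK hba hbc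
  obtain ⟨e, her, -⟩ := QuarticCMDihedral.exists_mulEquiv_dihedralGroup_four h4 hK hba hbc hσ hτ
  have he2 : e (DihedralGroup.r 2) = conjGal (L := L) := by
    rw [her, show (2 : ZMod 4).val = 2 from rfl, QuarticCMDihedral.sigma_sq h4 hba hbc hσ]
  -- the subset as a Boolean function on `D₄`
  obtain ⟨γ', hγ'1, hγ'⟩ := dihedralGroup_four_exists_ne_one_forall_mul_eq (fun d => decide (e d ∈ S))
    (fun d => by
      have h := hS (e d)
      change decide (e d ∈ S) = !decide (e (DihedralGroup.r 2 * d) ∈ S)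
      rw [map_mul, he2]
      by_cases hm : conjGal (L := L) * e d ∈ S
      · have h' : e d ∉ S := fun h'' => (h.1 h'') hm
        simp [h', hm]
      · have h' : e d ∈ S := h.2 hm
        simp [h', hm])
  refine ⟨e γ', fun h1 => hγ'1 (e.injective (by rw [h1, map_one])), fun δ => ?_⟩
  have h2 := hγ' (e.symm δ)
  change decide (e (e.symm δ * γ') ∈ S) = decide (e (e.symm δ) ∈ S) at h2
  rw [map_mul, e.apply_symm_apply] at h2
  exact decide_eq_decide.1 h2

/-- `ι ∘ (ρδ) = \overline{ι ∘ δ}`: precomposition with complex conjugation of the CM field `L` is complex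
conjugation of the embedding. [cite: Shimura1998, §18.2 Lemma (i)] -/
private theorem comp_conjGal_mul (ι : L →+* ℂ) (δ : L ≃ₐ[ℚ] L) :
    ι.comp ((conjGal (L := L) * δ : L ≃ₐ[ℚ] L) : L →+* L) = conjugate (ι.comp (δ : L →+* L)) := by
  refine RingHom.ext fun x => ?_
  change ι (conjGal (L := L) (δ x)) = starRingEnd ℂ (ι (δ x))
  rw [conjGal_apply]
  exact IsCMField.complexEmbedding_complexConj L ι (δ x)

/-- **NO complex CM type of the dihedral Galois closure `L` is primitive** (at any base embedding `φ₀`): with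
`Θ` read in `G` through a fixed embedding `ι`, the right stabiliser `γ ≠ 1` of §1 makes the distinct embeddings `ι`
and `ι ∘ γ` inseparable by the translates of `Θ` (Shimura §8.2 Prop. 26 in the separation form
`isPrimitive_iff_forall_eq`). [cite: Shimura1998, §8.4 Examples (1), (2)(C) and §8.2 Prop. 26] -/
theorem not_isPrimitive_of_isNormalClosure (h4 : Module.finrank ℚ K = 4) (hK : ¬ IsGalois ℚ K) (Θ : CMType L)
    (φ₀ : L →+* ℂ) : ¬ IsPrimitive (ℂ ≃+* ℂ) Θ.1 φ₀ := by
  classical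
  haveI : IsGalois ℚ L := isGalois_of_isNormalClosure K
  haveI := isPretransitive_ringEquiv_complex (K := L)
  set ι := φ₀ with hι
  -- `Θ` read in `G`
  set S : Set (L ≃ₐ[ℚ] L) := {δ | ι.comp (δ : L →+* L) ∈ Θ.1} with hS_def
  have hS : ∀ δ : L ≃ₐ[ℚ] L, δ ∈ S ↔ conjGal (L := L) * δ ∉ S := fun δ => by
    change ι.comp (δ : L →+* L) ∈ Θ.1 ↔ ι.comp ((conjGal (L := L) * δ : L ≃ₐ[ℚ] L) : L →+* L) ∉ Θ.1
    rw [comp_conjGal_mul]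
    exact CMTypeOps.mem_iff_conjugate_notMem Θ _
  obtain ⟨γ, hγ1, hγ⟩ := exists_ne_one_mul_mem_iff h4 hK S hS
  -- the two inseparable embeddings
  intro hprim
  rw [isPrimitive_iff_forall_eq] at hprim
  have hne : ι.comp (γ : L →+* L) ≠ ι := by
    intro h
    apply hγ1
    ext x
    exact ι.injective (RingHom.congr_fun h x)
  refine hne (hprim _ _ fun g => ?_).symm |> fun h => h
  -- `g ∘ ι = ι ∘ δ` for some `δ ∈ G`, and then `g ∘ (ι ∘ γ) = ι ∘ (δγ)`
  obtain ⟨δ, hδ⟩ := exists_comp_algEquiv_eq ι (g • ι)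
  have h1 : g • ι.comp (γ : L →+* L) = ι.comp ((δ * γ : L ≃ₐ[ℚ] L) : L →+* L) := by
    change (g : ℂ →+* ℂ).comp (ι.comp (γ : L →+* L)) = _
    rw [← RingHom.comp_assoc]
    change (g • ι).comp (γ : L →+* L) = _
    rw [← hδ]
    rfl
  have h2 : g • ι = ι.comp ((δ : L ≃ₐ[ℚ] L) : L →+* L) := hδ.symm
  rw [h2, h1]
  change δ ∈ S ↔ δ * γ ∈ S
  exact (hγ δ).symm

/-- **NO complex CM type of the dihedral Galois closure is nondegenerate** (nondegenerate types are primitive,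
Kubota). [cite: Kubota1965, §2 (p. 115)] [cite: Shimura1998, §8.4 Example (2)(C)] -/
theorem not_isNondegenerate_of_isNormalClosure (h4 : Module.finrank ℚ K = 4) (hK : ¬ IsGalois ℚ K) (Θ : CMType L) :
    ¬ IsNondegenerate Θ := fun hnd =>
  not_isPrimitive_of_isNormalClosure h4 hK Θ (Classical.arbitrary _) (hnd.isPrimitive _)

end Galois

/-! ### §3 Galois CM fields of degree `8` receiving a non-Galois quartic CM field -/

section Octic

variable {K : Type} [Field K] [NumberField K] [IsCMField K] {F : Type} [Field F] [NumberField F] [IsCMField F]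

omit [IsCMField F] in
/-- A Galois field `F` of degree `8` over `ℚ` receiving a non-Galois quartic CM field `K` (as a `K`-algebra
compatible with `ℚ`) is a normal closure of `K`: the normal closure of `K` inside `F` has degree `8`.
[cite: Shimura1998, §8.4 Example (2)(C)] -/
theorem isNormalClosure_of_isGalois_octic (h4 : Module.finrank ℚ K = 4) (hK : ¬ IsGalois ℚ K) [Algebra K F]
    [IsScalarTower ℚ K F] [IsGalois ℚ F] (h8 : Module.finrank ℚ F = 8) : IsNormalClosure ℚ K F := by
  let j : K →ₐ[ℚ] F := IsScalarTower.toAlgHom ℚ K F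
  haveI : Nonempty (K →ₐ[ℚ] F) := ⟨j⟩
  -- the normal closure of `K` inside `F` is all of `F`
  haveI : NumberField ↥(normalClosure ℚ K F) := NumberField.mk
  haveI : IsNormalClosure ℚ K ↥(normalClosure ℚ K F) := isNormalClosure_normalClosure ℚ K F
  have h8' : Module.finrank ℚ ↥(normalClosure ℚ K F) = 8 :=
    finrank_normalClosure_eq_eight_of_not_isGalois (L := ↥(normalClosure ℚ K F)) h4 hK
  have htop : normalClosure ℚ K F = ⊤ :=
    IntermediateField.eq_of_le_of_finrank_eq le_top (by rw [h8', IntermediateField.finrank_top', h8])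
  rw [Algebra.IsAlgebraic.isNormalClosure_iff]
  refine ⟨fun x => ?_, htop⟩
  rw [← minpoly.algHom_eq j j.injective x]
  exact Normal.splits (F := ℚ) inferInstance (j x)

/-- **NO complex CM type of a Galois CM field of degree `8` receiving a non-Galois quartic CM field is primitive.**
[cite: Shimura1998, §8.4 Examples (1), (2)(C)] -/
theorem not_isPrimitive_of_isGalois_of_ringHom (h4 : Module.finrank ℚ K = 4) (hK : ¬ IsGalois ℚ K) [IsGalois ℚ F]
    (h8 : Module.finrank ℚ F = 8) (e : K →+* F) (Θ : CMType F) (φ₀ : F →+* ℂ) :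
    ¬ IsPrimitive (ℂ ≃+* ℂ) Θ.1 φ₀ := by
  letI : Algebra K F := e.toAlgebra
  haveI : IsScalarTower ℚ K F := IsScalarTower.of_algebraMap_eq fun q => (map_ratCast e q).symm
  haveI : IsNormalClosure ℚ K F := isNormalClosure_of_isGalois_octic h4 hK h8
  exact not_isPrimitive_of_isNormalClosure (K := K) h4 hK Θ φ₀

/-- **… nor nondegenerate**; in particular a simple CM abelian fourfold never has CM by such a field, and every CM
type of it gives degenerate families. [cite: Kubota1965, §2 (p. 115)] [cite: Shimura1998, §8.4 Example (2)(C)] -/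
theorem not_isNondegenerate_of_isGalois_of_ringHom (h4 : Module.finrank ℚ K = 4) (hK : ¬ IsGalois ℚ K)
    [IsGalois ℚ F] (h8 : Module.finrank ℚ F = 8) (e : K →+* F) (Θ : CMType F) : ¬ IsNondegenerate Θ := fun hnd =>
  not_isPrimitive_of_isGalois_of_ringHom h4 hK h8 e Θ (Classical.arbitrary _) (hnd.isPrimitive _)

end Octic

end Literature.NumberTheory.ComplexMultiplication
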